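import Literature.RepresentationTheory.MoeglinVignerasWaldspurger1987.RankOneThetaLiftNonvanishingProofs
import Literature.RepresentationTheory.TwistedCoinvariantsCompactIsotypic
import Literature.NumberTheory.Automorphic.Liu2021.LemD1IsotropyOfPlace
import Mathlib.MeasureTheory.Integral.Bochner.Basic
import HarnessLib

/-!
# [Li1992, Thm 2.1 (27)] — the LOCAL FACTOR of Rallis' inner product formula at a NON-SPLIT finite place is non-zero
# for the pair `(U(V), U(1))`, `dim V ≥ 3`: an explicit test vector (a `χ_v`-eigenvector of the compact torus)

J.-S. Li, *Non-vanishing theorems for the cohomology of certain arithmetic quotients*, J. reine angew. Math. **428** (1992),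
Theorem 2.1, second display (27) p. 184: for factorizable data the right-hand side of Rallis' inner product formula (26) is the
product over all places `v` of the LOCAL INTEGRALS `I_v = ∫_{G'_v} ⟨ω_v(h_v)φ_v, φ_v⟩ ⟨π_v(h_v) f_v, f_v⟩ dh_v`; §5 (Thm 5.4 a),
Cor. 5.5): in the stable range the local integrals can be made non-zero.  THIS FILE proves the non-vanishing of the local factor
at a NON-SPLIT finite place `v` of `F` for the rank-one member `G'_v = U(J₁)(F_v) = E_v¹` (a COMPACT torus) of the unitary pair
`(U(J), U(J₁))` acting on the local Schrödinger model `𝒮(F_vᴺ)` through the centre (`U(J₁)(F_v) → U(J)(F_v)`, `u ↦ u · 1`,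
tree `UnitaryGroup.localCenter` — for a hermitian LINE `J₁` this IS the `U(W)`-member of the see-saw pair `U(J_V ⊗ J_W)`):

* §1 `integral_coeff_mul_conj_eq_of_eigenvector` (generic, kernel): for a representation `ω` of a group `G` on `𝒮(X)`, a
  unitary character `χ`, a `χ`-EIGENVECTOR `Φ` and any `Ψ`, the `χ̄`-Fourier coefficient of the matrix coefficient is
  `∫_G ⟨ω(h)Φ, Ψ⟩ conj χ(h) dh = dh(G) · ⟨Φ, Ψ⟩` (`⟨Φ, Ψ⟩ = ∫ Φ Ψ̄ dμ_X`); and `integral_mul_conj_self_ne_zero`: `⟨Φ, Φ⟩ ≠ 0`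
  for `Φ ≠ 0` when `μ_X` charges open sets (a Schwartz–Bruhat function is locally constant with compact support).
* §2 `isIsotropic_standingData_of_three_le` (kernel): the hermitian space `(E_vᴺ, J ⊗ 1)` of the tree's standing data at a
  non-archimedean place is ISOTROPIC for `N ≥ 3` (its trace form is an `F_v`-quadratic form in `2N ≥ 6 > 4 = u(F_v)` variables;
  the argument of ★ `Liu2021/LemD1IsotropyOfPlace`, restated for the bare standing datum).
* §3 **`exists_eigenvector_ne_zero_of_nonsplit`**: at a non-split `v` (`E_v` a field), for every smooth splitting `s` of
  `U(J)(F_v)` over `ι_v` and every continuous unitary `χ` of `U(J₁)(F_v)`, `V` isotropic ⟹ there is a NON-ZERO `Φ ∈ 𝒮(F_vᴺ)` with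
  `ω_s(u · 1) Φ = χ(u) Φ` for all `u ∈ U(J₁)(F_v)` — ★ [MoeglinVignerasWaldspurger1987, Chap. 3 §IV.2] rank-one stable-range
  non-vanishing (`mvw_IV2_rankOne_nonvanishing_of_isotropic_holds`: the `χ`-coinvariants are non-zero) + ★ the compact-group
  dictionary «isotypic subspace ≅ coinvariants» ([BernsteinZelevinsky1976, §2.3], `TwistedCoinv.exists_mem_weightSpace_mk_eq`).
* §4 **`exists_localFactor_ne_zero_of_nonsplit`** / **`…_of_three_le`**: hence, for any Haar measure `dh` on the compact torus and
  any additive Haar measure `μ_X` on `F_vᴺ`, some `Φ ≠ 0` has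
  `∫_{U(J₁)(F_v)} ⟨ω_s(u·1)Φ, Φ⟩ conj χ(u) dh = dh(U(J₁)(F_v)) · ⟨Φ, Φ⟩ ≠ 0` — the local factor of (27) at `v` in the shape
  consumed by the finite half of the cell's S4′(ii) assembly (`F0/P4/SEAT-ii-MEMO-S4ii.v1` (F4), non-split places).

KERNEL only: theorems, no definition, no named fact, no `sorry`.  Cell hodgecm-mathlib, FLOOR 0, programme P4, crux item H413
(`--supports stmt-HodgeConjecture-24833`).  HC_CM is proved only modulo the printed citations until rung 0 closes; nothing here is a
claim about them.

## Mathlib / tree search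
`lean search`/`rg`: local factor / Fourier coefficient of a matrix coefficient against a character — `Li1992/SchwartzPairingFactorisation`
(`integral_archCoeff_mul_conj_of_eigen`, archimedean Schwartz currency) and `CompactGroups/IsotypicProjection` (Hilbert currency); nothing
for the local Schwartz–Bruhat model `𝒮(F_vᴺ)`.  Non-vanishing of coinvariants at a non-split place: ★
`MoeglinVignerasWaldspurger1987/RankOneThetaLiftNonvanishingProofs`; eigenvectors from coinvariants: ★ `TwistedCoinvariantsCompactIsotypic`;
positivity of `‖Φ‖²`: ★ `SchwartzBruhatL2Norm.l2NormSq_pos` (`ℝ≥0∞` currency; the Bochner form is proved here).  Mathlib: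
`MeasureTheory.integral_const`, `integral_pos_iff_support_of_nonneg`, `Continuous.integrable_of_hasCompactSupport`, `Complex.mul_conj'`.

## References
* [Li1992] J.-S. Li, J. reine angew. Math. 428 (1992) 177–217 — Thm 2.1 (26)–(27) p. 184; §5 Thm 5.4 a), Cor. 5.5 p. 206.
* [MoeglinVignerasWaldspurger1987] C. Mœglin, M.-F. Vignéras, J.-L. Waldspurger, LNM 1291 (1987), Chap. 3 §IV.2 Lemme (p. 76).
* [BernsteinZelevinsky1976] I. N. Bernstein, A. V. Zelevinsky, Russian Math. Surveys 31 (1976), §2.3.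
* [Lam2005] T. Y. Lam, *Introduction to quadratic forms over fields*, AMS GSM 67 (2005), Ch. VI Thm 2.12 (`u(F_v) = 4`).
-/

set_option autoImplicit false

noncomputable section

open NumberField IsDedekindDomain MeasureTheory
open scoped Matrix NNReal Topology ComplexConjugate
open Literature.RepresentationTheory Literature.RepresentationTheory.HeisenbergGroup
open Literature.NumberTheory.GelbartRogawski1991.UnitaryDualPair.LocalSplitting (iota LocalMp localSchrodinger)
open Literature.NumberTheory.Automorphic
open Literature.NumberTheory.Automorphic.UnitaryGroup
open Literature.NumberTheory.Automorphic.Liu2021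
open Literature.RepresentationTheory.MoeglinVignerasWaldspurger1987

namespace Literature.NumberTheory.Li1992

/-! ## §1 The Fourier coefficient of a matrix coefficient at an eigenvector; positivity of `⟨Φ, Φ⟩` -/

section Generic

variable {G : Type*} [Group G] [MeasurableSpace G] {X : Type*} [TopologicalSpace X] [MeasurableSpace X]

/-- **`∫_G ⟨ω(h)Φ, Ψ⟩ conj χ(h) dh = dh(G) · ⟨Φ, Ψ⟩` for a `χ`-eigenvector `Φ`** of a representation `ω` on `𝒮(X)`, `χ`
unitary (`⟨Φ, Ψ⟩ = ∫ Φ Ψ̄ dμ_X`): the integrand is the constant `χ(h) conj χ(h) ⟨Φ, Ψ⟩ = ⟨Φ, Ψ⟩`.  The local factor of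
[Li1992, (27)] at a place where the test vector is an eigenvector of the compact member. [cite: Li1992, Thm 2.1 (27) p. 184] -/
theorem integral_coeff_mul_conj_eq_of_eigenvector (dh : Measure G) (μX : Measure X)
    (ω : Representation ℂ G ↥(SchwartzBruhat X)) (χ : G →* ℂˣ) (hχu : ∀ h, ‖((χ h : ℂˣ) : ℂ)‖ = 1)
    {Φ : ↥(SchwartzBruhat X)} (hΦ : ∀ h, ω h Φ = ((χ h : ℂˣ) : ℂ) • Φ) (Ψ : ↥(SchwartzBruhat X)) :
    ∫ h, (∫ x, ((ω h Φ : ↥(SchwartzBruhat X)) : X → ℂ) x * conj (((Ψ : ↥(SchwartzBruhat X)) : X → ℂ) x) ∂μX) *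
        conj (((χ h : ℂˣ) : ℂ)) ∂dh =
      (dh.real Set.univ : ℂ) * ∫ x, ((Φ : ↥(SchwartzBruhat X)) : X → ℂ) x * conj (((Ψ : ↥(SchwartzBruhat X)) : X → ℂ) x) ∂μX := by
  have hconst : ∀ h, (∫ x, ((ω h Φ : ↥(SchwartzBruhat X)) : X → ℂ) x * conj (((Ψ : ↥(SchwartzBruhat X)) : X → ℂ) x) ∂μX) *
      conj (((χ h : ℂˣ) : ℂ)) =
      ∫ x, ((Φ : ↥(SchwartzBruhat X)) : X → ℂ) x * conj (((Ψ : ↥(SchwartzBruhat X)) : X → ℂ) x) ∂μX := by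
    intro h
    have hcoe : (((ω h Φ : ↥(SchwartzBruhat X)) : X → ℂ)) = ((χ h : ℂˣ) : ℂ) • ((Φ : ↥(SchwartzBruhat X)) : X → ℂ) := by
      rw [hΦ h, Submodule.coe_smul]
    have hunit : ((χ h : ℂˣ) : ℂ) * conj ((χ h : ℂˣ) : ℂ) = 1 := by
      simp [Complex.mul_conj', hχu h]
    simp_rw [hcoe, Pi.smul_apply, smul_eq_mul, mul_assoc, integral_const_mul]
    rw [mul_comm, ← mul_assoc, mul_comm (conj _), hunit, one_mul]
  simp_rw [hconst, integral_const, Complex.real_smul]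

/-- **`⟨Φ, Φ⟩ = ∫ |Φ|² dμ_X` is a real number**, as a complex number (the `L²(X)` inner product of the Schrödinger model restricted
to its smooth vectors, [Li1992, p. 178 and (13) p. 182]). [cite: Li1992, (13) p. 182] [cite: Weil1964, Chap. I n° 11] -/
theorem integral_mul_conj_self_eq_ofReal (μX : Measure X) (Φ : ↥(SchwartzBruhat X)) :
    ∫ x, ((Φ : ↥(SchwartzBruhat X)) : X → ℂ) x * conj (((Φ : ↥(SchwartzBruhat X)) : X → ℂ) x) ∂μX =
      ((∫ x, ‖((Φ : ↥(SchwartzBruhat X)) : X → ℂ) x‖ ^ 2 ∂μX : ℝ) : ℂ) := by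
  rw [← integral_complex_ofReal]
  refine integral_congr_ae (Filter.Eventually.of_forall fun x => ?_)
  dsimp only
  rw [Complex.mul_conj', Complex.ofReal_pow]

variable [OpensMeasurableSpace X]

/-- **`⟨Φ, Φ⟩ ≠ 0` for `Φ ≠ 0`** when `μ_X` charges every non-empty open set and is finite on compact sets: a non-zero
Schwartz–Bruhat function is a non-zero constant on a non-empty open set (cf. ★ `SchwartzBruhat.l2NormSq_pos`, `ℝ≥0∞` currency).
[cite: Weil1964, Chap. I n° 11] -/
theorem integral_mul_conj_self_ne_zero (μX : Measure X) [μX.IsOpenPosMeasure] [IsFiniteMeasureOnCompacts μX]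
    {Φ : ↥(SchwartzBruhat X)} (hΦ : Φ ≠ 0) :
    ∫ x, ((Φ : ↥(SchwartzBruhat X)) : X → ℂ) x * conj (((Φ : ↥(SchwartzBruhat X)) : X → ℂ) x) ∂μX ≠ 0 := by
  rw [integral_mul_conj_self_eq_ofReal, Complex.ofReal_ne_zero]
  have hlc : IsLocallyConstant ((Φ : ↥(SchwartzBruhat X)) : X → ℂ) := Φ.2.1
  have hcs : HasCompactSupport ((Φ : ↥(SchwartzBruhat X)) : X → ℂ) := Φ.2.2
  have hcont : Continuous fun x => ‖((Φ : ↥(SchwartzBruhat X)) : X → ℂ) x‖ ^ 2 :=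
    (continuous_norm.comp hlc.continuous).pow 2
  have hcs' : HasCompactSupport fun x => ‖((Φ : ↥(SchwartzBruhat X)) : X → ℂ) x‖ ^ 2 :=
    hcs.norm.comp_left (g := fun r : ℝ => r ^ 2) (by simp)
  have hint : Integrable (fun x => ‖((Φ : ↥(SchwartzBruhat X)) : X → ℂ) x‖ ^ 2) μX :=
    hcont.integrable_of_hasCompactSupport hcs'
  refine ((integral_pos_iff_support_of_nonneg (fun x => sq_nonneg _) hint).2 ?_).ne'
  -- the support is the (open, non-empty) support of `Φ`
  have hsupp : Function.support (fun x => ‖((Φ : ↥(SchwartzBruhat X)) : X → ℂ) x‖ ^ 2) =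
      Function.support ((Φ : ↥(SchwartzBruhat X)) : X → ℂ) := by
    ext x
    simp
  have hΦ' : ((Φ : ↥(SchwartzBruhat X)) : X → ℂ) ≠ 0 := fun h => hΦ (Subtype.ext h)
  obtain ⟨x₀, hx₀⟩ := Function.ne_iff.1 hΦ'
  have hopen : IsOpen (Function.support ((Φ : ↥(SchwartzBruhat X)) : X → ℂ)) := by
    rw [show Function.support ((Φ : ↥(SchwartzBruhat X)) : X → ℂ) =
        (((Φ : ↥(SchwartzBruhat X)) : X → ℂ) ⁻¹' {0})ᶜ from by ext x; simp [Function.mem_support]]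
    exact (hlc.isClosed_fiber 0).isOpen_compl
  rw [hsupp]
  exact hopen.measure_pos μX ⟨x₀, hx₀⟩

end Generic

/-! ## §2 Isotropy of the standing hermitian space at a finite place for `N ≥ 3` -/

section Isotropy

variable {F : Type} (E : Type) [Field F] [NumberField F] [Field E] [NumberField E] [Algebra F E]
  [Algebra.IsQuadraticExtension F E] (v : HeightOneSpectrum (𝓞 F)) (c : E ≃ₐ[F] E) (N : ℕ) {δ : E} (hcδ : c δ = -δ)
  (hδ : δ ≠ 0) (hN : 2 ≤ N) {J : Matrix (Fin N) (Fin N) E} (hJh : (J.map c)ᵀ = J) (hJdet : J.det ≠ 0)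

include hN in
/-- **for `N ≥ 3` the hermitian space `(E_vᴺ, J ⊗ 1)` of the standing data at a finite place `v` is ISOTROPIC**: otherwise its
trace form would be an anisotropic `F_v`-quadratic form in `2N ≥ 6` variables (★ `exists_quadraticForm_trace_form`,
`form_self_eq_zero_of_trace_eq_zero`, `five_le_finrank_pi_localRing`), contradicting `u(F_v) = 4` (★
`QuadraticForms.not_anisotropic_of_five_le_finrank_adicCompletion`).  The hypothesis `hiso` of [MVW, IV.2] at rank `≥ 3`.
[cite: Lam2005, Ch. VI Thm 2.12] [cite: MoeglinVignerasWaldspurger1987, Chap. 1 I.1] -/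
theorem isIsotropic_standingData_of_three_le (h3 : 3 ≤ N) :
    LemD1.IsIsotropic (LemD1OfPlace.standingData E v c N J hcδ hδ hN hJh hJdet) := by
  by_contra hnot
  obtain ⟨Q, hQ⟩ := (LemD1OfPlace.standingData E v c N J hcδ hδ hN hJh hJdet).exists_quadraticForm_trace_form
  refine QuadraticForms.not_anisotropic_of_five_le_finrank_adicCompletion F v Q
    (LemD1OfPlace.five_le_finrank_pi_localRing E v h3) fun x hx => ?_
  by_contra hx0
  refine hnot ⟨x, hx0, ?_⟩
  rw [hQ] at hx
  exact LemD1OfPlace.form_self_eq_zero_of_trace_eq_zero E v c N J hcδ hδ hN hJh hJdet x hx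

end Isotropy

/-! ## §3 A non-zero `χ`-eigenvector of the compact torus at a non-split place -/

section Nonsplit

variable (F : Type) [Field F] [NumberField F] (E : Type) [Field E] [NumberField E] [Algebra F E]
  [Algebra.IsQuadraticExtension F E] (c : E ≃ₐ[F] E) (N : ℕ) (δ : E) (hcδ : c δ = -δ) (hδ : δ ≠ 0) (d : F)
  (hd : δ * δ = algebraMap F E d) (T : Matrix (Fin N) (Fin N) F) (hT : T.IsSymm) (hTd : IsUnit T.det)
  (J : Matrix (Fin N) (Fin N) E) (hJ : J = T.map (algebraMap F E)) (v : HeightOneSpectrum (𝓞 F))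
  (hE : IsField (UnitaryGroup.LocalRing E v))
  (hN : 2 ≤ N) (hJh : (J.map c)ᵀ = J) (hJdet : J.det ≠ 0)
  (s : UnitaryGroup.localPi E c N J v →* LocalMp F N T v)
  (hs : ∀ g, MpPsi.proj _ (s g) = iota F E c N hcδ hδ hd T hT hJ v g)
  (hsm : Representation.IsSmooth ((MpPsi.toRep (localSchrodinger F N T v)).comp s))
  (J₁ : Matrix (Fin 1) (Fin 1) E) (hJ₁ : J₁ 0 0 ≠ 0) (χ : UnitaryGroup.localPi E c 1 J₁ v →* ℂˣ)
  (hχu : ∀ z, ‖((χ z : ℂˣ) : ℂ)‖ = 1) (hχc : Continuous fun z => ((χ z : ℂˣ) : ℂ))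

include hE hTd hs hsm hχu hχc in
/-- **A NON-ZERO `χ`-EIGENVECTOR at a non-split place.**  At a finite place `v` of `F` that does not split in `E` (`E_v` a field),
for every smooth splitting `s : U(J)(F_v) → S̃p_{ψ_v}` over `ι_v`, every hermitian line `J₁` and every continuous unitary character
`χ` of the compact torus `U(J₁)(F_v) = E_v¹` acting on `𝒮(F_vᴺ)` through the centre `u ↦ ω_s(u · 1)`: if `(E_vᴺ, J ⊗ 1)` is isotropic
there is `Φ ≠ 0` with `ω_s(u · 1) Φ = χ(u) Φ` for all `u`.  [MVW, IV.2] gives non-zero `χ`-coinvariants; for the compact torus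
with smooth action and open `ker χ` every coinvariant class is the class of an eigenvector ([BernsteinZelevinsky1976, §2.3]).
[cite: MoeglinVignerasWaldspurger1987, Chap. 3 §IV.2 Lemme (p. 76)] [cite: BernsteinZelevinsky1976, §2.3] -/
theorem exists_eigenvector_ne_zero_of_nonsplit
    (hiso : LemD1.IsIsotropic (LemD1OfPlace.standingData E v c N J hcδ hδ hN hJh hJdet)) :
    ∃ Φ : ↥(SchwartzBruhat (Fin N → v.adicCompletion F)), Φ ≠ 0 ∧
      ∀ z, ((MpPsi.toRep (localSchrodinger F N T v)).comp s) (UnitaryGroup.localCenter E c N J J₁ hJ₁ v z) Φ =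
        ((χ z : ℂˣ) : ℂ) • Φ := by
  classical
  -- the non-split place: compact torus, smooth action, open kernel (as in ★ `mvw_IV2_rankOne_nonvanishing_of_isotropic_holds` §0)
  have hc1 : c ≠ 1 := by
    rintro rfl
    exact hδ (self_eq_neg.1 (by simpa only [AlgEquiv.one_apply] using hcδ))
  obtain ⟨w⟩ := (inferInstance : Nonempty (PlacesOver E v))
  have hw : c • w.1 = w.1 := by
    by_contra hw
    exact LemD1IndexedNonVacuityAtPlace.not_isField_localRing_of_split E v c w hw hE
  haveI : CompactSpace (localPi E c 1 J₁ v) := compactSpace_localPi_one_of_smul_eq c J₁ hc1 hJ₁ w hw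
  let M : Representation ℂ (localPi E c 1 J₁ v) ↥(SchwartzBruhat (Fin N → v.adicCompletion F)) :=
    ((MpPsi.toRep (localSchrodinger F N T v)).comp s).comp (localCenter E c N J J₁ hJ₁ v)
  have hMs : M.IsSmooth := fun Φ =>
    show IsOpen ((localCenter E c N J J₁ hJ₁ v) ⁻¹'
      ((Representation.stabilizerSubgroup ((MpPsi.toRep (localSchrodinger F N T v)).comp s) Φ :
        Subgroup (localPi E c N J v)) : Set (localPi E c N J v))) from
      (hsm Φ).preimage (continuous_localCenter E c N J J₁ hJ₁ v)
  have hχo : IsOpen (χ.ker : Set (localPi E c 1 J₁ v)) := isOpen_ker_of_smul_eq c J₁ hc1 hJ₁ w hw χ hχc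
  -- [MVW IV.2]: the `χ`-coinvariants of `M` are non-zero
  have hnt : Nontrivial (TwistedCoinv.Coinv M χ) :=
    mvw_IV2_rankOne_nonvanishing_of_isotropic_holds F E c N δ hcδ hδ d hd T hT hTd J hJ v hE hN hJh hJdet hiso s hs hsm J₁ hJ₁
      χ hχu hχc
  obtain ⟨x, hx⟩ := exists_ne (0 : TwistedCoinv.Coinv M χ)
  obtain ⟨w₀, rfl⟩ := TwistedCoinv.mk_surjective M χ x
  -- compact-group dictionary: the class of `w₀` is the class of an eigenvector
  obtain ⟨Φ, hΦ, hΦw⟩ := TwistedCoinv.exists_mem_weightSpace_mk_eq M χ hMs hχo w₀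
  refine ⟨Φ, ?_, fun z => (mem_weightSpace.1 hΦ) z⟩
  rintro rfl
  rw [map_zero] at hΦw
  exact hx hΦw.symm

end Nonsplit

/-! ## §4 The local factor of (27) at a non-split place is non-zero -/

section LocalFactor

variable (F : Type) [Field F] [NumberField F] (E : Type) [Field E] [NumberField E] [Algebra F E]
  [Algebra.IsQuadraticExtension F E] (c : E ≃ₐ[F] E) (N : ℕ) (δ : E) (hcδ : c δ = -δ) (hδ : δ ≠ 0) (d : F)
  (hd : δ * δ = algebraMap F E d) (T : Matrix (Fin N) (Fin N) F) (hT : T.IsSymm) (hTd : IsUnit T.det)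
  (J : Matrix (Fin N) (Fin N) E) (hJ : J = T.map (algebraMap F E)) (v : HeightOneSpectrum (𝓞 F))
  (hE : IsField (UnitaryGroup.LocalRing E v))
  (hN : 2 ≤ N) (hJh : (J.map c)ᵀ = J) (hJdet : J.det ≠ 0)
  (s : UnitaryGroup.localPi E c N J v →* LocalMp F N T v)
  (hs : ∀ g, MpPsi.proj _ (s g) = iota F E c N hcδ hδ hd T hT hJ v g)
  (hsm : Representation.IsSmooth ((MpPsi.toRep (localSchrodinger F N T v)).comp s))
  (J₁ : Matrix (Fin 1) (Fin 1) E) (hJ₁ : J₁ 0 0 ≠ 0) (χ : UnitaryGroup.localPi E c 1 J₁ v →* ℂˣ)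
  (hχu : ∀ z, ‖((χ z : ℂˣ) : ℂ)‖ = 1) (hχc : Continuous fun z => ((χ z : ℂˣ) : ℂ))
  [MeasurableSpace (Fin N → v.adicCompletion F)] [OpensMeasurableSpace (Fin N → v.adicCompletion F)]
  (μX : Measure (Fin N → v.adicCompletion F)) [μX.IsOpenPosMeasure] [IsFiniteMeasureOnCompacts μX]
  [MeasurableSpace (UnitaryGroup.localPi E c 1 J₁ v)]
  (dh : Measure (UnitaryGroup.localPi E c 1 J₁ v)) [dh.IsOpenPosMeasure] [IsFiniteMeasure dh]

include hE hTd hs hsm hχu hχc in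
/-- **THE LOCAL FACTOR OF (27) AT A NON-SPLIT PLACE IS NON-ZERO** (`V = (E_vᴺ, J ⊗ 1)` isotropic — automatic for `N ≥ 3`,
`…_of_three_le` below): for any finite measure `dh` charging open sets on the compact torus `U(J₁)(F_v)` (e.g. a Haar measure) and
any measure `μ_X` on `F_vᴺ` charging open sets and finite on compacts (e.g. an additive Haar measure), there is a test vector
`Φ ∈ 𝒮(F_vᴺ)`, `Φ ≠ 0`, a `χ`-eigenvector of `u ↦ ω_s(u · 1)`, with
`∫_{U(J₁)(F_v)} ⟨ω_s(u·1)Φ, Φ⟩ conj χ(u) dh = dh(U(J₁)(F_v)) · ⟨Φ, Φ⟩ ≠ 0` (`⟨Φ, Ψ⟩ = ∫ Φ Ψ̄ dμ_X`).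
[cite: Li1992, Thm 2.1 (27) p. 184; Thm 5.4 a) p. 206] [cite: MoeglinVignerasWaldspurger1987, Chap. 3 §IV.2 Lemme (p. 76)] -/
theorem exists_localFactor_ne_zero_of_nonsplit
    (hiso : LemD1.IsIsotropic (LemD1OfPlace.standingData E v c N J hcδ hδ hN hJh hJdet)) :
    ∃ Φ : ↥(SchwartzBruhat (Fin N → v.adicCompletion F)), Φ ≠ 0 ∧
      (∀ z, ((MpPsi.toRep (localSchrodinger F N T v)).comp s) (UnitaryGroup.localCenter E c N J J₁ hJ₁ v z) Φ =
        ((χ z : ℂˣ) : ℂ) • Φ) ∧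
      (∫ z, (∫ x, ((((MpPsi.toRep (localSchrodinger F N T v)).comp s) (UnitaryGroup.localCenter E c N J J₁ hJ₁ v z) Φ :
            ↥(SchwartzBruhat (Fin N → v.adicCompletion F))) : (Fin N → v.adicCompletion F) → ℂ) x *
          conj (((Φ : ↥(SchwartzBruhat (Fin N → v.adicCompletion F))) : (Fin N → v.adicCompletion F) → ℂ) x) ∂μX) *
          conj (((χ z : ℂˣ) : ℂ)) ∂dh =
        (dh.real Set.univ : ℂ) *
          ∫ x, ((Φ : ↥(SchwartzBruhat (Fin N → v.adicCompletion F))) : (Fin N → v.adicCompletion F) → ℂ) x *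
            conj (((Φ : ↥(SchwartzBruhat (Fin N → v.adicCompletion F))) : (Fin N → v.adicCompletion F) → ℂ) x) ∂μX) ∧
      (∫ z, (∫ x, ((((MpPsi.toRep (localSchrodinger F N T v)).comp s) (UnitaryGroup.localCenter E c N J J₁ hJ₁ v z) Φ :
            ↥(SchwartzBruhat (Fin N → v.adicCompletion F))) : (Fin N → v.adicCompletion F) → ℂ) x *
          conj (((Φ : ↥(SchwartzBruhat (Fin N → v.adicCompletion F))) : (Fin N → v.adicCompletion F) → ℂ) x) ∂μX) *
          conj (((χ z : ℂˣ) : ℂ)) ∂dh) ≠ 0 := by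
  obtain ⟨Φ, hΦ0, hΦ⟩ := exists_eigenvector_ne_zero_of_nonsplit F E c N δ hcδ hδ d hd T hT hTd J hJ v hE hN hJh hJdet s hs hsm
    J₁ hJ₁ χ hχu hχc hiso
  have heq := integral_coeff_mul_conj_eq_of_eigenvector dh μX
    (((MpPsi.toRep (localSchrodinger F N T v)).comp s).comp (UnitaryGroup.localCenter E c N J J₁ hJ₁ v)) χ hχu
    (Φ := Φ) (fun z => hΦ z) Φ
  simp only [MonoidHom.comp_apply] at heq hΦ ⊢
  refine ⟨Φ, hΦ0, hΦ, heq, ?_⟩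
  rw [heq]
  refine mul_ne_zero ?_ (integral_mul_conj_self_ne_zero μX hΦ0)
  -- `dh(U(J₁)(F_v)) ≠ 0`: the torus is non-empty and open sets are charged; the measure is finite
  have hpos : 0 < dh Set.univ := isOpen_univ.measure_pos dh ⟨1, Set.mem_univ _⟩
  have hreal : 0 < dh.real Set.univ := ENNReal.toReal_pos hpos.ne' (measure_ne_top dh _)
  exact_mod_cast hreal.ne'

include hE hTd hs hsm hχu hχc hJh hJdet in
/-- **The local factor at a non-split place is non-zero, `N ≥ 3`** (isotropy discharged by `isIsotropic_standingData_of_three_le`):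
the (F4) input of the finite half of the cell's S4′(ii) assembly at every non-split finite place of `L⁺`, for the pair
`(U(J_V ⊗ (a)), U((a)))` read through the centre. [cite: Li1992, Thm 2.1 (27) p. 184; Thm 5.4 a) p. 206]
[cite: MoeglinVignerasWaldspurger1987, Chap. 3 §IV.2 Lemme (p. 76)] [cite: Lam2005, Ch. VI Thm 2.12] -/
theorem exists_localFactor_ne_zero_of_nonsplit_of_three_le (h3 : 3 ≤ N) :
    ∃ Φ : ↥(SchwartzBruhat (Fin N → v.adicCompletion F)), Φ ≠ 0 ∧
      (∀ z, ((MpPsi.toRep (localSchrodinger F N T v)).comp s) (UnitaryGroup.localCenter E c N J J₁ hJ₁ v z) Φ =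
        ((χ z : ℂˣ) : ℂ) • Φ) ∧
      (∫ z, (∫ x, ((((MpPsi.toRep (localSchrodinger F N T v)).comp s) (UnitaryGroup.localCenter E c N J J₁ hJ₁ v z) Φ :
            ↥(SchwartzBruhat (Fin N → v.adicCompletion F))) : (Fin N → v.adicCompletion F) → ℂ) x *
          conj (((Φ : ↥(SchwartzBruhat (Fin N → v.adicCompletion F))) : (Fin N → v.adicCompletion F) → ℂ) x) ∂μX) *
          conj (((χ z : ℂˣ) : ℂ)) ∂dh =
        (dh.real Set.univ : ℂ) *
          ∫ x, ((Φ : ↥(SchwartzBruhat (Fin N → v.adicCompletion F))) : (Fin N → v.adicCompletion F) → ℂ) x *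
            conj (((Φ : ↥(SchwartzBruhat (Fin N → v.adicCompletion F))) : (Fin N → v.adicCompletion F) → ℂ) x) ∂μX) ∧
      (∫ z, (∫ x, ((((MpPsi.toRep (localSchrodinger F N T v)).comp s) (UnitaryGroup.localCenter E c N J J₁ hJ₁ v z) Φ :
            ↥(SchwartzBruhat (Fin N → v.adicCompletion F))) : (Fin N → v.adicCompletion F) → ℂ) x *
          conj (((Φ : ↥(SchwartzBruhat (Fin N → v.adicCompletion F))) : (Fin N → v.adicCompletion F) → ℂ) x) ∂μX) *
          conj (((χ z : ℂˣ) : ℂ)) ∂dh) ≠ 0 :=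
  exists_localFactor_ne_zero_of_nonsplit F E c N δ hcδ hδ d hd T hT hTd J hJ v hE (Nat.le_of_succ_le h3) hJh hJdet s hs hsm J₁ hJ₁
    χ hχu hχc μX dh (isIsotropic_standingData_of_three_le E v c N hcδ hδ (Nat.le_of_succ_le h3) hJh hJdet h3)

end LocalFactor

end Literature.NumberTheory.Li1992

end
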